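import Summits.QuantumFields.QCD.Theorems.GapBuysCauchyRateRotationRestorationOfPlanarWard
import Summits.QuantumFields.QCD.Theorems.GapBuysCauchyRateRotationRestorationOnePointFactorisation
import Summits.QuantumFields.QCD.Theorems.GapBuysCauchyRateRotationRestorationOnePointInvariance
import HarnessLib.Audit

/-!
# Skeleton (line `registered` = birth, reshape r2b by the line lead) for crux `RotationRestoration`
(item stmt-QuantumFields-8840)

Route `GapBuysCauchyRate` (sub-problem QCD; the crux is shared verbatim with `DiagonalSpine` and
`FourMirrorsWardE1`), crux decl `Summit.QuantumFields.QCD.Theses.GapBuysCauchyRate.RotationRestoration`: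
for every `N_f`, every sequential lattice-QCD scheme `sch` with two-loop asymptotic scaling, bare Wilson
masses eventually on the physical branch and a uniform lattice mass gap, every labelled Schwinger family
`S` that is the `k → ∞` limit of the honest lattice `n`-point functions on off-diagonal real tensors is
invariant under every determinant-one linear isometry of `ℝ⁴` on `⁰𝒮` (E1, rotation half).

## History of the line (all landed pieces are imported; this file now carries ONE stub)
* birth (registrar): Hypercubic → PlanarWard → Totality → crux via `PlanarToEuclidean.so4_generation`.
* r1 (lead): hyperoctahedral stub replaced by EXACT even-axis-permutation covariance + Givens generation from
  three coordinate `SO(2)`'s.  LANDED: Defs + S4 `stub_so4FromCoordinatePlanes` (p147247), S1a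
  `stub_latticePermCovariance` (p149351), S1b `stub_latticeInvariancePassesToLimit` (p150397), S1c
  `stub_evenPermSpinor` (p151311), S3 `stub_separatedTensorsTotal` (p151153), and the sorry-free conditional
  composition `RotationRestoration_of_planarWard : PlanarWardOnSeparatedTensors → RotationRestoration`
  (`Theorems/GapBuysCauchyRateRotationRestorationOfPlanarWard.lean`, p152334).
* r2 (lead): S2 sliced by degree.  LANDED: T1 `stub_onePointFactorisation` (p153035: the lattice one-point
  function is `w_k(σ) · a_k⁴ ∑_{x ∈ box} f(a_k x)` by torus translation covariance), T2
  `stub_onePointInvariance` (p153439: Riemann sums + the tie ⇒ tied `S 1 σ = w · ∫`, invariant under every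
  linear isometry).  Degree `0` is the identity action.  The conditional composition through degrees `≥ 2`,
  `RotationRestoration_of_planarWardTwoLe`, is proposed as
  `Theorems/GapBuysCauchyRateRotationRestorationOfPlanarWardTwoLe.lean`.
* r2b (this file): the ONLY registered stub is S2' `stub_planarWardOnSeparatedTensorsTwoLe` — planar
  `SO(2)₀₁`-invariance of tied limits on separated real tensors of degree `n ≥ 2`: the crux's physics, to
  which the crux is now EQUIVALENT.

## Negative knowledge honoured
* No `Cruxes/RotationRestoration/Disproof.lean` exists (2026-08-17T10Z).  Refuter crux-attack 2026-08-15: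
  SURVIVES.  Strategist census N0/N2/N3: the stub keeps the tie and every scheme-side hypothesis verbatim;
  model-blind (`S`-intrinsic) attacks are excluded by N2's anisotropic OS zoo, junk schemes (`z ≡ 0`, static
  quarks) satisfy it trivially (N1/N3).
* Yang–Mills negatives `NPointIsotropy/Negative/*`: excluded (separated tensors; the tie is kept).
-/

noncomputable section

namespace Summit.QuantumFields.QCD.Cruxes.RotationRestoration.Birth

open scoped BigOperators Topology SchwartzMap
open Filter
open Literature.MathematicalPhysics.QuantumLattice Literature.MathematicalPhysics.AQFT
  Literature.MathematicalPhysics.QuantumFieldTheory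
open Literature.Probability.LatticeModels (box)
open Summit.QuantumFields.QCD.Theses.GapBuysCauchyRate (RotationRestoration)

/-! ## §2 The one registered stub (the ONLY `sorry` of this file)

The signature is written WITHOUT file-local notation so that a helper file can reproduce the registered
header verbatim (`open`s as above). -/

/-- **(S2') Planar Ward restoration on separated tensors of degree `n ≥ 2`** (THE hard stub; open problem).
Under the crux's hypotheses — two-loop asymptotic scaling, bare masses eventually on the physical branch, a
uniform lattice mass gap, the tie — `S n σ (F ∘ R⁻¹) = S n σ F` for every determinant-one isometry `R` fixing
`e₂, e₃` and every separated real tensor `F` of degree `n ≥ 2`.  Why plausibly true (the route's engine): the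
`θ`-derivative of `S n σ (F ∘ R_θ⁻¹)` is the limit of the lattice rotation Ward identity in the
`(x₀,x₁)`-plane, whose hypercubic-to-`O(4)` defect is `a_k²` times an insertion of dimension-6 operators
(CCMP lattice energy–momentum tensor); lattice-gap clustering bounds the volume sum and `k`-uniform insertion
bounds (the unbuilt UV output) kill the `a_k²`.  Equivalent lattice-side form (under the tie): for separated
`f` of degree `≥ 2`, `qcdLatticeSchwinger sch k n σ (f ∘ R⁻¹) − qcdLatticeSchwinger sch k n σ f → 0`.  Why
it might fail: every `N_f` (≥ 17 is a junk regime), all `z_s(k)`, every sequential limit. -/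
theorem stub_planarWardOnSeparatedTensorsTwoLe :
    ∀ (Nf : ℕ) (sch : QCDScheme Nf), sch.HasAsymptoticScaling →
      (∀ fl : Fin Nf, ∀ᶠ k in atTop, -1 < sch.mq fl k) →
        (∃ Δ : ℝ, 0 < Δ ∧ sch.HasLatticeMassGap Δ) →
          ∀ S : LabelledSchwingerFamily (QCDField Nf) (EuclideanSpace ℝ (Fin 4)), IsLatticeLimit sch S →
            ∀ n : ℕ, 2 ≤ n → ∀ (σ : Fin n → QCDField Nf)
              (R : EuclideanSpace ℝ (Fin 4) ≃ₗᵢ[ℝ] EuclideanSpace ℝ (Fin 4)), IsPlanar R →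
              ∀ f : Fin n → 𝓢(EuclideanSpace ℝ (Fin 4), ℝ), IsSeparated f →
                ∀ F : 𝓢((Fin n → EuclideanSpace ℝ (Fin 4)), ℂ), IsTensorOf F (fun i => ofRealTest (f i)) →
                  S n σ (linActMulti R F) = S n σ F := by
  sorry

/-! ### Name-keyed alias of the stub statement (hypothesis of the composition) -/
namespace Registered

/-- Statement of S2' keyed by the registered stub name. -/
abbrev stub_planarWardOnSeparatedTensorsTwoLe : Prop :=
  ∀ (Nf : ℕ) (sch : QCDScheme Nf), sch.HasAsymptoticScaling →
    (∀ fl : Fin Nf, ∀ᶠ k in atTop, -1 < sch.mq fl k) →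
      (∃ Δ : ℝ, 0 < Δ ∧ sch.HasLatticeMassGap Δ) →
        ∀ S : LabelledSchwingerFamily (QCDField Nf) (EuclideanSpace ℝ (Fin 4)), IsLatticeLimit sch S →
          ∀ n : ℕ, 2 ≤ n → ∀ (σ : Fin n → QCDField Nf)
            (R : EuclideanSpace ℝ (Fin 4) ≃ₗᵢ[ℝ] EuclideanSpace ℝ (Fin 4)), IsPlanar R →
            ∀ f : Fin n → 𝓢(EuclideanSpace ℝ (Fin 4), ℝ), IsSeparated f →
              ∀ F : 𝓢((Fin n → EuclideanSpace ℝ (Fin 4)), ℂ), IsTensorOf F (fun i => ofRealTest (f i)) →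
                S n σ (linActMulti R F) = S n σ F

end Registered

/-! ## §3 Composition (sorry-free below this line; everything imported is landed) -/

/-- **Planar Ward restoration on separated tensors from its degree-`≥ 2` slice**: degree `0` is the identity
action (`LatticeInvariancePassesToLimit.linActMulti_fin_zero`), degree `1` is `stub_onePointInvariance` fed
with `stub_onePointFactorisation` (both landed). -/
theorem planarWard_of (h : Registered.stub_planarWardOnSeparatedTensorsTwoLe) :
    PlanarWardOnSeparatedTensors := by
  intro Nf sch hAF hbr hgap S hlim n σ R hR f hf F hF
  rcases n with _ | _ | n
  · rw [LatticeInvariancePassesToLimit.linActMulti_fin_zero]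
  · exact stub_onePointInvariance Nf sch S hlim (fun k τ => stub_onePointFactorisation Nf sch k τ) σ R f hf
      F hF
  · exact h Nf sch hAF hbr hgap S hlim (n + 2) (by omega) σ R hR f hf F hF

/-- **The crux from the one remaining stub statement** (concludes `RotationRestoration` BY NAME), through the
landed `RotationRestoration_of_planarWard`. -/
theorem RotationRestoration_of_twoLe (h : Registered.stub_planarWardOnSeparatedTensorsTwoLe) :
    RotationRestoration :=
  RotationRestoration_of_planarWard (planarWard_of h)

/-! ## §4 The crux along the skeleton -/

/-- The crux along this skeleton (sorry only inside the stub): the `GapBuysCauchyRate` copy. -/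
theorem RotationRestoration_skeleton : RotationRestoration :=
  RotationRestoration_of_twoLe stub_planarWardOnSeparatedTensorsTwoLe

/-- **The skeleton under the primary name** (the hypothesis-free `<Crux>_proof` the skeleton check reads; its
`sorry`-cone is exactly the one registered stub): `FourMirrorsWardE1.RotationRestoration`. -/
theorem RotationRestoration_proof :
    Summit.QuantumFields.QCD.Theses.FourMirrorsWardE1.RotationRestoration :=
  RotationRestoration_of_planarWard_primary (planarWard_of stub_planarWardOnSeparatedTensorsTwoLe)

/-- The skeleton under the name `DiagonalSpine.RotationRestoration`. -/
theorem RotationRestoration_proof_diagonalSpine :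
    Summit.QuantumFields.QCD.Theses.DiagonalSpine.RotationRestoration :=
  RotationRestoration_of_planarWard_diagonalSpine (planarWard_of stub_planarWardOnSeparatedTensorsTwoLe)

/-- The skeleton under the name `GapBuysCauchyRate.RotationRestoration` (= `RotationRestoration_skeleton`). -/
theorem RotationRestoration_proof_gapBuysCauchyRate :
    Summit.QuantumFields.QCD.Theses.GapBuysCauchyRate.RotationRestoration :=
  RotationRestoration_skeleton

/-- Composition from the stub statement, concluding the PRIMARY copy (sorry-free). -/
theorem RotationRestoration_of_primary (h : Registered.stub_planarWardOnSeparatedTensorsTwoLe) :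
    Summit.QuantumFields.QCD.Theses.FourMirrorsWardE1.RotationRestoration :=
  RotationRestoration_of_planarWard_primary (planarWard_of h)

end Summit.QuantumFields.QCD.Cruxes.RotationRestoration.Birth

end
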